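import Literature.MathematicalPhysics.QuantumFieldTheory.Balaban1983to89.B9Ineq347CoReading
import Literature.MathematicalPhysics.QuantumFieldTheory.Balaban1983to89.B9Ineq347GAAtLetters
import Literature.MathematicalPhysics.QuantumFieldTheory.Balaban1983to89.B9IndexBondAtLevel

/-!
# `Balaban1983to89.B9Ineq347CoReadingAtLetters` — the (3.47) co-reading `CoReadsGlob` IS DISCHARGEABLE at def-Y's bond-sector readings: entry 0
# of `Node00.kernelFamilyB` from a dominating model operator and a LEVEL-FAITHFUL TOTAL block map on the fine bonds

T. Bałaban, *Propagators for lattice gauge theories in a background field*, Commun. Math. Phys. **99** (1985) 389–434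
[`Balaban1985BackgroundPropagators`, "B9"].

statement-level skeleton of published theorems with citation tags; proofs where landed; nothing here is a claim about the
Yang–Mills mass gap

THE PRINTED LOCI.  (3.41) p. 397 *"the norm |A|_{(α)} can be defined as the smallest number C such, that |A(b)| ≦ C(Lʲη)^α for b ∈ Ω_j∖Ω_{j+1}"*;
(3.47) p. 398 (the global weighted entries, vector arguments: Thm 3.3 p. 399 *"the same statements hold for the operators G(U)"*).

THE POINT (pattern for the instance seat; companion of `B9Ineq347CoReading`).  The row-20∕21 leaves `…B9Thm312WholeLeafCoGlob.thm312Printed_of_stepDHG`,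
`…B9Thm313WholeLeafCoGlob.thm313Printed_of_stepDG` feed the (3.47) members through the co-reading `CoReadsGlob K n U bu bv ev A` of the family by a MODEL
operator on real coordinate lattices with TOTAL block maps — in place of n06-h's `GlobReading`, which has no instance face at the geometry of record
(`B9GlobReadingOrphan`).  THIS FILE shows that the replacement IS dischargeable at def-Y's reading `Node00.kernelFamilyB i B cfg O par` of ANY bond-sector
letter `O` (so for `GA GD G₁ GG Kdiff` alike), entry n = 0, at any configuration `U₁`, GIVEN: (i) a block map `bI : FBondY i → IBondY i` on the fine
bonds that is LEVEL-FAITHFUL (`lvl (bI x) = level of the block of x` — total by construction; at members with orphan blocks the orphan fine bonds are sent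
to a same-level index bond nearby, cell memo `ORPHAN-BLOCKS-MEMO.md` §4 R3), (ii) the evaluation `ev (.inr J) = J`, `ev (.inl f) = 0` of the sum-typed
arguments on the bond model lattice, (iii) DOMINATION of the letter by the real model operator `A` on product-form arguments: ‖(O(U₁)(J ⊗ E))(x)‖ ≦
|(AJ)(x)| for ‖E‖ ≦ 1 — the same obligation the (3.42) co-reading `CoRealizes.obs` of the knit carries (at U = 1 it is the printed clause `GA_one` with
A = Δ_a⁻¹, equality up to ‖E‖).  Then ★ `coReadsGlob_zero_kernelFamilyB`: `CoReadsGlob (kernelFamilyB i B cfg O par) 0 U₁ bI bI ev A` — `wbound` is the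
pointwise form of (3.41) (`abs_le_of_wNormB_le`), `obs` is «the smallest C such that …» (`wNormBY_le_of_pointwise`) under the sup over the unit ball.
Entries n = 1, 2 (∇_U∘O, O∘∇*_U) follow the same two lemmas once the instance fixes the derivative model lattice; not typed here.
v1.1 (§3): with `B9IndexBondAtLevel.exists_levelFaithful_kIdx` the level-faithful map EXISTS at every member, so ★★ `exists_coReadsGlob_zero_GA_one` —
the co-reading of G(1) holds outright at every member (orphan blocks or not), for every letter record.

HONEST SCOPE.  A dischargeability pattern: nothing of [B9] asserted; the level-faithful map and the domination are HYPOTHESES the instance seat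
(node00-def-Y) supplies; count-neutral; N06 NOT discharged; one finite lattice programme — nothing continuum, nothing about the mass gap.  Cell
`pub-ymgap` (HUMAN RULING D-0062), Track A node N06 [B9], seat `pub-ymgap-dag-n06-l` (g3), 2026-08-27.
-/

noncomputable section

namespace Literature.MathematicalPhysics.QuantumFieldTheory.Balaban1983to89.B9Ineq347CoReadingAtLetters

open B6SectAOperatorsV1 (BondIdx)
open B6GlobalChartV1 (PV domT blkV1)
open B6Ineq2142KLevelV1 (β lvl)
open B6KLevelCensusIndexV1 (KIdx)
open B9GeoNormsKLevelV1 (geo9K wNormB wNormU wNormB_nonneg geo9K_wNorm_nonneg blkV1_level_le abs_le_of_wNormB_le)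
open B9Ineq347CoReading (CoReadsGlob)
open B9Ineq347GAAtLetters (wNormBY_le_of_pointwise)
open Node00 (SiteY FBondY BlkY IBondY CfgY BallY liftY norm_liftY_le wNormBY kernelFamilyB BondOpY BondParY iSup_ball_le)

variable {d ℓ : ℕ} {hd : 1 ≤ d + 1} {hL : Odd (ℓ + 1) ∧ 1 < ℓ + 1} {b₀ b₁ : ℝ}
variable {𝔸 : Type} [NormedRing 𝔸] [NormedAlgebra ℂ 𝔸] [CompleteSpace 𝔸]

section BondLetter

variable (i : KIdx d ℓ hd hL b₀ b₁) (B : B9.Backgrounds) (cfg : B.Cfg → CfgY 𝔸 i) (O : BondOpY 𝔸 i) (par : BondParY 𝔸 i) (U₁ : B.Cfg)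

/-- the scale length of the index bond `bI x` IS `L^{j(x)}|c_f|⁻¹` when the block map is level-faithful. [cite: Balaban1985BackgroundPropagators, (3.41) p.397 (the weights), bookkeeping] -/
theorem len_bI_eq {bI : FBondY i → IBondY i} (hlev : ∀ x : FBondY i, lvl i.hN i.D i.hk (bI x) = (blkV1 i.hN i.D x).1.1) (x : FBondY i) :
    (geo9K i).len (bI x) = ((ℓ : ℝ) + 1) ^ (blkV1 i.hN i.D x).1.1 * |i.cf|⁻¹ := by
  show (((ℓ + 1 : ℕ) : ℝ)) ^ (lvl i.hN i.D i.hk (bI x)) * |i.cf|⁻¹ = _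
  rw [hlev x]
  push_cast
  rfl

/-- `t² · t^γ = t^{2+γ}` for the positive scale length `t = L^{j}|c_f|⁻¹`. [folklore] -/
private theorem sq_mul_rpow (x : FBondY i) (γ : ℝ) :
    (((ℓ : ℝ) + 1) ^ (blkV1 i.hN i.D x).1.1 * |i.cf|⁻¹) ^ 2 * (((ℓ : ℝ) + 1) ^ (blkV1 i.hN i.D x).1.1 * |i.cf|⁻¹) ^ γ =
      (((ℓ : ℝ) + 1) ^ (blkV1 i.hN i.D x).1.1 * |i.cf|⁻¹) ^ ((2 : ℝ) + γ) := by
  have ht : 0 < ((ℓ : ℝ) + 1) ^ (blkV1 i.hN i.D x).1.1 * |i.cf|⁻¹ :=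
    mul_pos (pow_pos (by positivity) _) (inv_pos.2 (abs_pos.2 i.hcf))
  rw [Real.rpow_add ht, Real.rpow_two]

/-- ★ **THE (3.47) CO-READING, ENTRY 0, IS DISCHARGEABLE AT def-Y's READING OF ANY BOND-SECTOR LETTER**: given a level-faithful total block map
`bI` on the fine bonds, the evaluation `ev` of the sum-typed arguments on the bond lattice (`.inr J ↦ J`, `.inl f ↦ 0`) and a real model operator `A`
dominating the letter on product-form arguments at the configuration `U₁` (‖(O(cfg U₁)(J ⊗ E))(x)‖ ≦ |(AJ)(x)| for ‖E‖ ≦ 1),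
`CoReadsGlob (kernelFamilyB i B cfg O par) 0 U₁ bI bI ev A` holds: `wbound` by the pointwise form of (3.41), `obs` by «the smallest C such that …» and the
sup over the unit ball. [cite: Balaban1985BackgroundPropagators, (3.41) p.397 + (3.47) p.398] -/
theorem coReadsGlob_zero_kernelFamilyB {bI : FBondY i → IBondY i} (hlev : ∀ x : FBondY i, lvl i.hN i.D i.hk (bI x) = (blkV1 i.hN i.D x).1.1)
    {ev : (geo9K i).Loc → FBondY i → ℝ} (hev_inr : ∀ (J : FBondY i → ℝ) (x : FBondY i), ev (Sum.inr J) x = J x)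
    (hev_inl : ∀ (f : SiteY i → ℝ) (x : FBondY i), ev (Sum.inl f) x = 0)
    {A : (FBondY i → ℝ) →ₗ[ℝ] (FBondY i → ℝ)}
    (hdom : ∀ (J : FBondY i → ℝ) (E : BallY 𝔸) (x : FBondY i), ‖O (cfg U₁) (liftY J (E : 𝔸)) x‖ ≤ |A J x|) :
    CoReadsGlob (kernelFamilyB i B cfg O par) 0 U₁ bI bI ev A := by
  refine ⟨?_, ?_⟩
  · -- `wbound`: |ev λ (x′)| ≤ (L^{j(x′)}η)^γ · |λ|_{(γ)}
    intro lam γ x'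
    rw [len_bI_eq i hlev x']
    cases lam with
    | inl f =>
        rw [hev_inl, abs_zero]
        exact mul_nonneg (Real.rpow_nonneg (mul_nonneg (pow_nonneg (by positivity) _) (inv_nonneg.2 (abs_nonneg _))) _)
          (geo9K_wNorm_nonneg i γ _)
    | inr J =>
        rw [hev_inr]
        have h := abs_le_of_wNormB_le i (le_refl (wNormB i γ J)) x'
        rw [mul_comm] at h
        push_cast at h
        exact h
  · -- `obs`: «the smallest C such that …» under the sup over the unit ball
    intro lam γ C hC hx
    cases lam with
    | inl f => exact hC
    | inr J =>
        have hJ : ev (Sum.inr J) = J := funext (hev_inr J)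
        rw [hJ] at hx
        show (⨆ E : BallY 𝔸, ((![wNormBY i (2 + γ) (O (cfg U₁) (liftY J (E : 𝔸))),
            ⨆ ν : Fin (d + 1), wNormBY i (1 + γ) (Node00.cdB i (cfg U₁) ν (O (cfg U₁) (liftY J (E : 𝔸)))),
            ⨆ ν : Fin (d + 1), wNormBY i (1 + γ) (O (cfg U₁) (Node00.cdsB i (cfg U₁) ν (liftY J (E : 𝔸)))),
            wNormBY i γ (Node00.lapB i (cfg U₁) (O (cfg U₁) (liftY J (E : 𝔸))))] : Fin 4 → ℝ) 0)) ≤ C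
        refine iSup_ball_le (fun E => ?_) hC
        simp only [Matrix.cons_val_zero]
        refine wNormBY_le_of_pointwise i hC fun b => (hdom J E b).trans ?_
        have h := hx b
        rw [len_bI_eq i hlev b] at h
        simp only [B9.pref4, Matrix.cons_val_zero] at h
        rwa [mul_assoc, sq_mul_rpow i b γ] at h

end BondLetter

/-! ## §2 Worked instance: G(1) at a member, dominated by r03's `Gop = Δ_a⁻¹` through the printed clause `GA_one` -/

section AtOne

variable {Mstar : ℕ} {G : Subgroup 𝔸ˣ} (x : B9PinMembersKLevelV1.MemberY d ℓ hd hL b₀ b₁ Mstar) (𝔏 : Node00.CovLettersY 𝔸 x)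
  (𝔈 : Node00.ExpLettersY 𝔸 G x)

/-- ★ **AT U = 1 THE CO-READING OF G IS DISCHARGED OUTRIGHT** (no domination hypothesis left): by def-Y's printed clause `GA_one`
(G(1)(J ⊗ E) = (Δ_a⁻¹J) ⊗ E) and ‖E‖ ≦ 1 the letter is dominated by r03's genuine `Gop = Δ_a⁻¹`, so for every level-faithful total block map
`bI` and the evaluation `ev` of §1, `CoReadsGlob (operatorLayerYOfLetters 𝔸 G x 𝔏 𝔈).GA 0 1 bI bI ev (Gop x.toKIdx)` — the (3.47) companion of
n06-g's (3.42) comparison `B9Cor35ComparisonsGAAtLetters.kernelFamilyB_e_one_le`. [cite: Balaban1985BackgroundPropagators, Cor. 3.5 p.407 + (3.41) p.397 + (3.47) p.398; Balaban1984PropagatorsII, (2.22) p.226] -/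
theorem coReadsGlob_zero_GA_one {bI : FBondY x.toKIdx → IBondY x.toKIdx}
    (hlev : ∀ b : FBondY x.toKIdx, lvl x.hN x.D x.hk (bI b) = (blkV1 x.hN x.D b).1.1)
    {ev : (geo9K x.toKIdx).Loc → FBondY x.toKIdx → ℝ} (hev_inr : ∀ (J : FBondY x.toKIdx → ℝ) (b : FBondY x.toKIdx), ev (Sum.inr J) b = J b)
    (hev_inl : ∀ (f : SiteY x.toKIdx → ℝ) (b : FBondY x.toKIdx), ev (Sum.inl f) b = 0) :
    CoReadsGlob (Node00.operatorLayerYOfLetters 𝔸 G x 𝔏 𝔈).GA 0 (B9PinMembersKLevelV1.bg9Y 𝔸 G x).one bI bI ev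
      (B6Prop26Census2136KLevelV1.Gop x.toKIdx) :=
  coReadsGlob_zero_kernelFamilyB x.toKIdx (B9PinMembersKLevelV1.bg9Y 𝔸 G x) (fun U => U) 𝔏.GA 𝔏.parB _ hlev hev_inr hev_inl
    fun J E b => by
      change ‖𝔏.GA (fun _ _ => 1) (liftY J (E : 𝔸)) b‖ ≤ _
      rw [𝔏.GA_one]
      exact norm_liftY_le _ E b

end AtOne

/-! ## §3 (v1.1) The co-reading of G(1) holds OUTRIGHT at every member: the level-faithful map exists (`B9IndexBondAtLevel`) -/

section AtOneExists

variable {Mstar : ℕ} {G : Subgroup 𝔸ˣ} (x : B9PinMembersKLevelV1.MemberY d ℓ hd hL b₀ b₁ Mstar) (𝔏 : Node00.CovLettersY 𝔸 x)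
  (𝔈 : Node00.ExpLettersY 𝔸 G x)

/-- ★★ **AT EVERY MEMBER — orphan blocks or not — THE (3.47) CO-READING OF G(1) IS SATISFIED OUTRIGHT** for every letter record: a level-faithful
total block map exists (`B9IndexBondAtLevel.exists_levelFaithful_kIdx`), the evaluation is `(.inr J ↦ J, .inl f ↦ 0)`, and the model operator is
r03's `Gop = Δ_a⁻¹` (`coReadsGlob_zero_GA_one`).  Contrast: the reading axioms `GlobReading` of G(1) are REFUTED at members with an orphan block
(`B9GlobReadingOrphan.not_hRGA_opsYOfLetters_of_orphan`). [cite: Balaban1985BackgroundPropagators, Cor. 3.5 p.407 + (3.41) p.397 + (3.47) p.398; Balaban1984PropagatorsII, (2.3)–(2.4) p.224 + (2.22) p.226] -/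
theorem exists_coReadsGlob_zero_GA_one :
    ∃ (bI : FBondY x.toKIdx → IBondY x.toKIdx) (ev : (geo9K x.toKIdx).Loc → FBondY x.toKIdx → ℝ),
      CoReadsGlob (Node00.operatorLayerYOfLetters 𝔸 G x 𝔏 𝔈).GA 0 (B9PinMembersKLevelV1.bg9Y 𝔸 G x).one bI bI ev
        (B6Prop26Census2136KLevelV1.Gop x.toKIdx) := by
  obtain ⟨bI, hbI⟩ := B9IndexBondAtLevel.exists_levelFaithful_kIdx x.toKIdx
  exact ⟨bI, fun lam b => Sum.elim (fun _ => (0 : ℝ)) (fun J => J b) lam,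
    coReadsGlob_zero_GA_one x 𝔏 𝔈 hbI (fun _ _ => rfl) (fun _ _ => rfl)⟩

end AtOneExists

end Literature.MathematicalPhysics.QuantumFieldTheory.Balaban1983to89.B9Ineq347CoReadingAtLetters

end
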